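import Summits.CriticalPhenomena.PercolationContinuityZ3.Theorems.PercNearOneGluingNoHeavyLowerTailThreePointProductFormFibreTwoPortSubstitution
import Summits.CriticalPhenomena.PercolationContinuityZ3.Theorems.PercNearOneGluingNoHeavyLowerTailThreePointProductFormFibreTwoPortNetCounts
import HarnessLib

/-!
# The product form `#bad² ≤ #P1·#P2` in the fibre language: THE TWO-TERMINAL SUBSTITUTION THEOREM, COUNTING PART
# (Sahi programme, prover prim-sahi-p2 gen 55)

Support file (`--supports stmt-CriticalPhenomena-4575`, helper); last part of the formalisation of reduction R4 (memo
`run/shared/lean/prim/prim-sahi/FROM-prim-sahi-p2-gen55-REDUCTIONS.md` §0(0), §3).  Standard axioms, no sorries, no named facts, no definitions.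

With the conventions of `…FibreTwoPortSubstitution` (`zn, zr, Rr, Fl, Fn` given by their defining clauses) and of `…FibreTwoPortNetCounts`
(`endsN`; the antithetic class sizes `A' = #{p ↔ q in zn w and zn w̄}`, `CD' = #{p ↔ q in zn w, not in zn w̄}`, `DD' = #{neither}`), write for
Booleans `e, e'`:  `BadR(e,e')(z) :≡ ¬Rr z e a s ∧ ¬Rr z e a c ∧ ¬Rr z e s c ∧ (s ↔ c in Fl z e with virtual edge iff e')`,
`Pat(e,πp,πq)(z) :≡ (Rr z e a p ↔ πp) ∧ (Rr z e a q ↔ πq)`, and `ρ(e,πp,πq,e') := #{Pat(e,πp,πq) ∧ BadR(e,e')}` (rest events; `ρ` is an arbitrary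
function with this defining clause `hρ`).
* `card_filter_split_bool` [this work] — `#{S} = #{S ∧ (X ↔ true)} + #{S ∧ (X ↔ false)}`.
* `card_bad_eq_sum` [this work] — `#bad = Σ_{e,πp,πq,e'} #{NE(e,πp,πq,e') ∧ Pat ∧ BadR(e,e')}` (four splits + the master lemma `bad_iff_restBad`).
* `card_piece_mul_univ` [this work] — independence: `#{NE ∧ (Pat ∧ BadR)}·#univ = ν(e,πp,πq,e')·ρ(e,πp,πq,e')`.
* **`card_bad_substitution`** [this work] — THE SUBSTITUTION IDENTITY for `#bad`:
  `#bad·#univ = A'·Σ_π ρ(1,π,1) + CD'·(ρ(1,∅,1) + ρ(0,∅,0) + Σ_{π≠∅}(ρ(1,π,0) + ρ(0,π,1))) + DD'·Σ_π ρ(0,π,0)`;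
  the three brackets are `#bad` of the rest with the network CONTRACTED (virtual edge on before and after the flat), replaced by ONE EDGE (open:
  on before, on after iff no port in the apex cluster; closed: off before, on after iff a port in the apex cluster), DELETED — memo §3.
* `card_sa_substitution` [this work] — the same for `#P1` (and `#P2`): `#P1·#univ = (A'+CD')·#{P1-rest with e=1} + (CD'+DD')·#{P1-rest with e=0}`.
* `sq_add_le_mul_add` [this work] — the convex-cone lemma `b₁² ≤ p₁q₁ → b₂² ≤ p₂q₂ → (b₁+b₂)² ≤ (p₁+p₂)(q₁+q₂)` (ℕ), by which (P) for the three
  bracket-triples implies (P) for `H` (memo §0(2)).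
[folklore] (counting); [cite: Gladkov2024, Conjecture 10.1 (p. 18), arXiv:2408.08457] for CONJECTURE (P).
-/

namespace Summit.CriticalPhenomena.PercolationContinuityZ3.Theorems.ProductFormFibre

open Finset Literature.Probability.Percolation
open Summit.CriticalPhenomena.PercolationContinuityZ3.Theorems.ThreePointCPIClusterSwap (clusterFlip)

variable {V α : Type*}

/-! ### 0. Two counting helpers -/

section Helpers

variable [Fintype α] [DecidableEq α]

/-- Splitting a count by the truth value of a predicate, indexed by a Boolean. [folklore] -/
theorem card_filter_split_bool (S X : (α → Bool) → Prop) [DecidablePred S] [DecidablePred X] :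
    (univ.filter S).card =
      (univ.filter fun z => S z ∧ (X z ↔ true = true)).card + (univ.filter fun z => S z ∧ (X z ↔ false = true)).card := by
  classical
  rw [← Finset.card_filter_add_card_filter_not (s := univ.filter S) X, Finset.filter_filter, Finset.filter_filter]
  congr 2
  · ext z; simp only [Finset.mem_filter, iff_true]
  · ext z; simp only [Finset.mem_filter, Bool.false_eq_true, iff_false]

/-- **The convex-cone lemma**: `b₁² ≤ p₁q₁`, `b₂² ≤ p₂q₂` imply `(b₁+b₂)² ≤ (p₁+p₂)(q₁+q₂)` (the set `{b² ≤ pq}` is a convex cone). [folklore] -/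
theorem sq_add_le_mul_add (b₁ b₂ p₁ q₁ p₂ q₂ : ℕ) (h₁ : b₁ ^ 2 ≤ p₁ * q₁) (h₂ : b₂ ^ 2 ≤ p₂ * q₂) :
    (b₁ + b₂) ^ 2 ≤ (p₁ + p₂) * (q₁ + q₂) := by
  -- `2 b₁ b₂ ≤ p₁ q₂ + p₂ q₁` from `(2 b₁ b₂)² ≤ 4 (p₁ q₂)(p₂ q₁) ≤ (p₁ q₂ + p₂ q₁)²`
  have hsq : (2 * b₁ * b₂) * (2 * b₁ * b₂) ≤ (p₁ * q₂ + p₂ * q₁) * (p₁ * q₂ + p₂ * q₁) := by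
    have h12 : (b₁ * b₂) ^ 2 ≤ (p₁ * q₂) * (p₂ * q₁) := by
      calc (b₁ * b₂) ^ 2 = b₁ ^ 2 * b₂ ^ 2 := by ring
        _ ≤ (p₁ * q₁) * (p₂ * q₂) := Nat.mul_le_mul h₁ h₂
        _ = (p₁ * q₂) * (p₂ * q₁) := by ring
    have amgm : 4 * ((p₁ * q₂) * (p₂ * q₁)) ≤ (p₁ * q₂ + p₂ * q₁) * (p₁ * q₂ + p₂ * q₁) := by
      nlinarith [Nat.zero_le ((p₁ * q₂ - p₂ * q₁) * (p₁ * q₂ - p₂ * q₁)), sq_nonneg ((p₁ * q₂ : ℤ) - p₂ * q₁)]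
    calc (2 * b₁ * b₂) * (2 * b₁ * b₂) = 4 * (b₁ * b₂) ^ 2 := by ring
      _ ≤ 4 * ((p₁ * q₂) * (p₂ * q₁)) := Nat.mul_le_mul_left 4 h12
      _ ≤ _ := amgm
  have hmid : 2 * b₁ * b₂ ≤ p₁ * q₂ + p₂ * q₁ := Nat.mul_self_le_mul_self_iff.1 hsq
  calc (b₁ + b₂) ^ 2 = b₁ ^ 2 + b₂ ^ 2 + 2 * b₁ * b₂ := by ring
    _ ≤ p₁ * q₁ + p₂ * q₂ + (p₁ * q₂ + p₂ * q₁) := Nat.add_le_add (Nat.add_le_add h₁ h₂) hmid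
    _ = (p₁ + p₂) * (q₁ + q₂) := by ring

end Helpers

section SubstitutionCount

variable (ends endsN : α → Sym2 V) (p q a s c : V) (Nv : Set V) (inN : α → Prop)
  (hN1 : ∀ l, inN l → ∀ v ∈ ends l, v ∈ Nv ∨ v = p ∨ v = q) (hN2 : ∀ l, ¬ inN l → ∀ v ∈ ends l, v ∉ Nv)
  (hp : p ∉ Nv) (hq : q ∉ Nv) (ha : a ∉ Nv) (hs : s ∉ Nv) (hc : c ∉ Nv)
  (hE1 : ∀ l, inN l → endsN l = ends l) (hE2 : ∀ l, ¬ inN l → endsN l = s(p, p))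
  (zn zr : (α → Bool) → α → Bool)
  (hzn : ∀ z l, inN l → zn z l = z l) (hzn0 : ∀ z l, ¬ inN l → zn z l = false)
  (hzr : ∀ z l, ¬ inN l → zr z l = z l) (hzr0 : ∀ z l, inN l → zr z l = false)
  (Rr : (α → Bool) → Bool → V → V → Prop)
  (hRr : ∀ z e u v, Rr z e u v ↔
    ((openGraph (labelledOpen ends (zr z))).Reachable u v ∨
      (e = true ∧ (((openGraph (labelledOpen ends (zr z))).Reachable u p ∧ (openGraph (labelledOpen ends (zr z))).Reachable q v) ∨
        ((openGraph (labelledOpen ends (zr z))).Reachable u q ∧ (openGraph (labelledOpen ends (zr z))).Reachable p v)))))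
  (Fl : (α → Bool) → Bool → α → Bool)
  (hFl1 : ∀ z e l, ¬ inN l → (∃ v ∈ ends l, Rr z e a v) → Fl z e l = !z l)
  (hFl2 : ∀ z e l, ¬ inN l → ¬ (∃ v ∈ ends l, Rr z e a v) → Fl z e l = z l)
  (hFl0 : ∀ z e l, inN l → Fl z e l = false)
  (Fn : (α → Bool) → Bool → Bool → α → Bool)
  (hFn1 : ∀ z πp πq l, inN l →
    ((πp = true ∧ ∃ v ∈ ends l, (openGraph (labelledOpen ends (zn z))).Reachable p v) ∨
      (πq = true ∧ ∃ v ∈ ends l, (openGraph (labelledOpen ends (zn z))).Reachable q v)) → Fn z πp πq l = !z l)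
  (hFn2 : ∀ z πp πq l, inN l →
    ¬ ((πp = true ∧ ∃ v ∈ ends l, (openGraph (labelledOpen ends (zn z))).Reachable p v) ∨
      (πq = true ∧ ∃ v ∈ ends l, (openGraph (labelledOpen ends (zn z))).Reachable q v)) → Fn z πp πq l = z l)
  (hFn0 : ∀ z πp πq l, ¬ inN l → Fn z πp πq l = false)
  -- the rest events, abstractly: `Bd z e e'` = BadR, and the count `ρ`
  (Bd : (α → Bool) → Bool → Bool → Prop)
  (hBd : ∀ z e e', Bd z e e' ↔
    ((¬ Rr z e a s ∧ ¬ Rr z e a c ∧ ¬ Rr z e s c) ∧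
      ((openGraph (labelledOpen ends (Fl z e))).Reachable s c ∨
        (e' = true ∧ (((openGraph (labelledOpen ends (Fl z e))).Reachable s p ∧ (openGraph (labelledOpen ends (Fl z e))).Reachable q c) ∨
          ((openGraph (labelledOpen ends (Fl z e))).Reachable s q ∧ (openGraph (labelledOpen ends (Fl z e))).Reachable p c))))))

/-! ### 1. Agreement lemmas: network events see only network labels, rest events only rest labels -/

include hzn hzn0 in
/-- The network part depends only on the network labels. [this work] -/
theorem zn_eq_of_agree {z z' : α → Bool} (h : ∀ l, inN l → z l = z' l) : zn z = zn z' := by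
  funext l
  by_cases hl : inN l
  · rw [hzn z l hl, hzn z' l hl, h l hl]
  · rw [hzn0 z l hl, hzn0 z' l hl]

include hzr hzr0 in
/-- The rest part depends only on the rest labels. [this work] -/
theorem zr_eq_of_agree {z z' : α → Bool} (h : ∀ l, ¬ inN l → z l = z' l) : zr z = zr z' := by
  funext l
  by_cases hl : inN l
  · rw [hzr0 z l hl, hzr0 z' l hl]
  · rw [hzr z l hl, hzr z' l hl, h l hl]

include hzn hzn0 hFn1 hFn2 hFn0 in
/-- The network flip depends only on the network labels. [this work] -/
theorem Fn_eq_of_agree {z z' : α → Bool} (h : ∀ l, inN l → z l = z' l) (πp πq : Bool) : Fn z πp πq = Fn z' πp πq := by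
  have hzz := zn_eq_of_agree inN zn hzn hzn0 h
  funext l
  by_cases hl : inN l
  · by_cases hcond : (πp = true ∧ ∃ v ∈ ends l, (openGraph (labelledOpen ends (zn z))).Reachable p v) ∨
        (πq = true ∧ ∃ v ∈ ends l, (openGraph (labelledOpen ends (zn z))).Reachable q v)
    · rw [hFn1 z πp πq l hl hcond, hFn1 z' πp πq l hl (by rw [← hzz]; exact hcond), h l hl]
    · rw [hFn2 z πp πq l hl hcond, hFn2 z' πp πq l hl (by rw [← hzz]; exact hcond), h l hl]
  · rw [hFn0 z πp πq l hl, hFn0 z' πp πq l hl]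

include hzr hzr0 hRr in
/-- The virtual-edge rest connectivity depends only on the rest labels. [this work] -/
theorem Rr_iff_of_agree {z z' : α → Bool} (h : ∀ l, ¬ inN l → z l = z' l) (e : Bool) (u v : V) : Rr z e u v ↔ Rr z' e u v := by
  rw [hRr, hRr, zr_eq_of_agree inN zr hzr hzr0 h]

include hzr hzr0 hRr hFl1 hFl2 hFl0 in
/-- The rest flat depends only on the rest labels. [this work] -/
theorem Fl_eq_of_agree {z z' : α → Bool} (h : ∀ l, ¬ inN l → z l = z' l) (e : Bool) : Fl z e = Fl z' e := by
  funext l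
  by_cases hl : inN l
  · rw [hFl0 z e l hl, hFl0 z' e l hl]
  · have hc : (∃ v ∈ ends l, Rr z e a v) ↔ (∃ v ∈ ends l, Rr z' e a v) := by
      simp only [Rr_iff_of_agree ends p q inN zr hzr hzr0 Rr hRr h]
    by_cases hcond : ∃ v ∈ ends l, Rr z e a v
    · rw [hFl1 z e l hl hcond, hFl1 z' e l hl (hc.1 hcond), h l hl]
    · rw [hFl2 z e l hl hcond, hFl2 z' e l hl (fun h' => hcond (hc.2 h')), h l hl]

/-! ### 2. The decomposition of `#bad` -/

variable [Fintype α] [DecidableEq α]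

include hN1 hN2 hp hq ha hs hc hzn hzn0 hzr hzr0 hRr hFl1 hFl2 hFl0 hFn1 hFn2 hFn0 hBd in
open Classical in
/-- **One piece.**  For fixed `(e, πp, πq, e')`, the bad configurations with these true values are exactly the configurations in the network
event `NE(e,πp,πq,e')` and in the rest event `Pat(e,πp,πq) ∧ BadR(e,e')` (master lemma `bad_iff_restBad`). [this work] -/
theorem filter_bad_piece (e πp πq e' : Bool) :
    (univ.filter fun z : α → Bool =>
      ((((((¬ (openGraph (labelledOpen ends z)).Reachable a s ∧ ¬ (openGraph (labelledOpen ends z)).Reachable a c ∧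
          ¬ (openGraph (labelledOpen ends z)).Reachable s c) ∧
        (openGraph (labelledOpen ends (clusterFlip ends a fun x => !z x))).Reachable s c) ∧
        ((openGraph (labelledOpen ends (zn z))).Reachable p q ↔ e = true)) ∧
        (Rr z e a p ↔ πp = true)) ∧
        (Rr z e a q ↔ πq = true)) ∧
        ((openGraph (labelledOpen ends (Fn z πp πq))).Reachable p q ↔ e' = true))) =
    (univ.filter fun z : α → Bool =>
      (((openGraph (labelledOpen ends (zn z))).Reachable p q ↔ e = true) ∧
        ((openGraph (labelledOpen ends (Fn z πp πq))).Reachable p q ↔ e' = true)) ∧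
      (((Rr z e a p ↔ πp = true) ∧ (Rr z e a q ↔ πq = true)) ∧ Bd z e e')) := by
  refine Finset.filter_congr fun z _ => ?_
  constructor
  · rintro ⟨⟨⟨⟨hbad, he⟩, hπp⟩, hπq⟩, he'⟩
    refine ⟨⟨he, he'⟩, ⟨hπp, hπq⟩, (hBd z e e').2 ?_⟩
    exact (bad_iff_restBad ends p q a Nv inN hN1 hN2 hp hq ha zn zr hzn hzn0 hzr hzr0 Rr hRr Fl hFl1 hFl2 hFl0 Fn hFn1 hFn2 hFn0
      z e πp πq e' hs hc he hπp hπq he').1 hbad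
  · rintro ⟨⟨he, he'⟩, ⟨hπp, hπq⟩, hB⟩
    refine ⟨⟨⟨⟨?_, he⟩, hπp⟩, hπq⟩, he'⟩
    exact (bad_iff_restBad ends p q a Nv inN hN1 hN2 hp hq ha zn zr hzn hzn0 hzr hzr0 Rr hRr Fl hFl1 hFl2 hFl0 Fn hFn1 hFn2 hFn0
      z e πp πq e' hs hc he hπp hπq he').2 ((hBd z e e').1 hB)

variable [DecidablePred inN]

include hzn hzn0 hzr hzr0 hRr hFl1 hFl2 hFl0 hFn1 hFn2 hFn0 hBd in
open Classical in
/-- **Independence of the piece**: `#{NE ∧ (Pat ∧ BadR)}·#univ = #NE · #(Pat ∧ BadR)`. [this work] -/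
theorem card_piece_mul_univ (e πp πq e' : Bool) :
    (univ.filter fun z : α → Bool =>
      (((openGraph (labelledOpen ends (zn z))).Reachable p q ↔ e = true) ∧
        ((openGraph (labelledOpen ends (Fn z πp πq))).Reachable p q ↔ e' = true)) ∧
      (((Rr z e a p ↔ πp = true) ∧ (Rr z e a q ↔ πq = true)) ∧ Bd z e e')).card * (univ : Finset (α → Bool)).card =
    (univ.filter fun z : α → Bool =>
      ((openGraph (labelledOpen ends (zn z))).Reachable p q ↔ e = true) ∧
        ((openGraph (labelledOpen ends (Fn z πp πq))).Reachable p q ↔ e' = true)).card *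
    (univ.filter fun z : α → Bool => ((Rr z e a p ↔ πp = true) ∧ (Rr z e a q ↔ πq = true)) ∧ Bd z e e').card := by
  refine card_and_mul_card_univ inN _ _ ?_ ?_
  · intro z z' h hz
    rwa [zn_eq_of_agree inN zn hzn hzn0 h, Fn_eq_of_agree ends p q inN zn hzn hzn0 Fn hFn1 hFn2 hFn0 h] at hz
  · intro z z' h hz
    have hR := fun (e : Bool) (u v : V) => Rr_iff_of_agree ends p q inN zr hzr hzr0 Rr hRr h e u v
    rw [hR, hR, hBd, hR, hR, hR, Fl_eq_of_agree ends p q a inN zr hzr hzr0 Rr hRr Fl hFl1 hFl2 hFl0 h] at hz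
    rw [hBd]; exact hz

/-! ### 3. The sixteen-fold split and the values of the network counts -/

omit [DecidablePred inN] in
/-- Four successive Boolean splits of a count. [folklore] -/
theorem card_split4 (S X₁ : (α → Bool) → Prop) (X₂ X₃ : Bool → (α → Bool) → Prop) (X₄ : Bool → Bool → Bool → (α → Bool) → Prop)
    [DecidablePred S] [DecidablePred X₁] [∀ e, DecidablePred (X₂ e)] [∀ e, DecidablePred (X₃ e)]
    [∀ e πp πq, DecidablePred (X₄ e πp πq)] :
    (univ.filter S).card = ∑ e : Bool, ∑ πp : Bool, ∑ πq : Bool, ∑ e' : Bool,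
      (univ.filter fun z => (((S z ∧ (X₁ z ↔ e = true)) ∧ (X₂ e z ↔ πp = true)) ∧ (X₃ e z ↔ πq = true)) ∧
        (X₄ e πp πq z ↔ e' = true)).card := by
  simp only [Fintype.sum_bool]
  rw [card_filter_split_bool S X₁,
    card_filter_split_bool (fun z => S z ∧ (X₁ z ↔ true = true)) (X₂ true),
    card_filter_split_bool (fun z => S z ∧ (X₁ z ↔ false = true)) (X₂ false),
    card_filter_split_bool (fun z => (S z ∧ (X₁ z ↔ true = true)) ∧ (X₂ true z ↔ true = true)) (X₃ true),
    card_filter_split_bool (fun z => (S z ∧ (X₁ z ↔ true = true)) ∧ (X₂ true z ↔ false = true)) (X₃ true),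
    card_filter_split_bool (fun z => (S z ∧ (X₁ z ↔ false = true)) ∧ (X₂ false z ↔ true = true)) (X₃ false),
    card_filter_split_bool (fun z => (S z ∧ (X₁ z ↔ false = true)) ∧ (X₂ false z ↔ false = true)) (X₃ false),
    card_filter_split_bool (fun z => ((S z ∧ (X₁ z ↔ true = true)) ∧ (X₂ true z ↔ true = true)) ∧ (X₃ true z ↔ true = true)) (X₄ true true true),
    card_filter_split_bool (fun z => ((S z ∧ (X₁ z ↔ true = true)) ∧ (X₂ true z ↔ true = true)) ∧ (X₃ true z ↔ false = true)) (X₄ true true false),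
    card_filter_split_bool (fun z => ((S z ∧ (X₁ z ↔ true = true)) ∧ (X₂ true z ↔ false = true)) ∧ (X₃ true z ↔ true = true)) (X₄ true false true),
    card_filter_split_bool (fun z => ((S z ∧ (X₁ z ↔ true = true)) ∧ (X₂ true z ↔ false = true)) ∧ (X₃ true z ↔ false = true)) (X₄ true false false),
    card_filter_split_bool (fun z => ((S z ∧ (X₁ z ↔ false = true)) ∧ (X₂ false z ↔ true = true)) ∧ (X₃ false z ↔ true = true)) (X₄ false true true),
    card_filter_split_bool (fun z => ((S z ∧ (X₁ z ↔ false = true)) ∧ (X₂ false z ↔ true = true)) ∧ (X₃ false z ↔ false = true)) (X₄ false true false),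
    card_filter_split_bool (fun z => ((S z ∧ (X₁ z ↔ false = true)) ∧ (X₂ false z ↔ false = true)) ∧ (X₃ false z ↔ true = true)) (X₄ false false true),
    card_filter_split_bool (fun z => ((S z ∧ (X₁ z ↔ false = true)) ∧ (X₂ false z ↔ false = true)) ∧ (X₃ false z ↔ false = true)) (X₄ false false false)]
  ring

omit [DecidablePred inN] in
include hE1 hE2 hzn hzn0 hFn1 hFn2 hFn0 in
open Classical in
/-- **The values of the network counts** `ν(e, πp, πq, e') = #{(p ↔ q in zn z ↔ e) ∧ (p ↔ q in Fn z πp πq ↔ e')}` in terms of the antithetic class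
sizes `A', CD', DD'` of the network (memo §3 table). [this work] -/
theorem card_NE_eq (A' CD' DD' : ℕ)
    (hA' : A' = (univ.filter fun w : α → Bool => (openGraph (labelledOpen ends (zn w))).Reachable p q ∧
      (openGraph (labelledOpen ends (zn fun l => !w l))).Reachable p q).card)
    (hCD' : CD' = (univ.filter fun w : α → Bool => (openGraph (labelledOpen ends (zn w))).Reachable p q ∧
      ¬ (openGraph (labelledOpen ends (zn fun l => !w l))).Reachable p q).card)
    (hDD' : DD' = (univ.filter fun w : α → Bool => ¬ (openGraph (labelledOpen ends (zn w))).Reachable p q ∧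
      ¬ (openGraph (labelledOpen ends (zn fun l => !w l))).Reachable p q).card)
    (e πp πq e' : Bool) :
    (univ.filter fun z : α → Bool =>
      ((openGraph (labelledOpen ends (zn z))).Reachable p q ↔ e = true) ∧
        ((openGraph (labelledOpen ends (Fn z πp πq))).Reachable p q ↔ e' = true)).card =
    (bif (πp || πq) then (bif e then (bif e' then A' else CD') else (bif e' then CD' else DD'))
      else (bif (e == e') then (bif e then A' + CD' else CD' + DD') else 0)) := by
  -- the two splits of `Cn'` and `Dn'` by the complement
  have hCn : (univ.filter fun w : α → Bool => (openGraph (labelledOpen ends (zn w))).Reachable p q).card = A' + CD' := by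
    rw [hA', hCD', card_filter_split_bool (fun w : α → Bool => (openGraph (labelledOpen ends (zn w))).Reachable p q)
      (fun w => (openGraph (labelledOpen ends (zn fun l => !w l))).Reachable p q)]
    congr 1
    · exact congrArg Finset.card (Finset.filter_congr fun w _ => by simp only [iff_true])
    · exact congrArg Finset.card (Finset.filter_congr fun w _ => by simp only [Bool.false_eq_true, iff_false])
  have hDC : (univ.filter fun w : α → Bool => ¬ (openGraph (labelledOpen ends (zn w))).Reachable p q ∧
      (openGraph (labelledOpen ends (zn fun l => !w l))).Reachable p q).card = CD' := by
    rw [hCD']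
    exact card_filter_compl_swap (fun w => ¬ (openGraph (labelledOpen ends (zn w))).Reachable p q)
      (fun w => (openGraph (labelledOpen ends (zn w))).Reachable p q)
  have hDn : (univ.filter fun w : α → Bool => ¬ (openGraph (labelledOpen ends (zn w))).Reachable p q).card = CD' + DD' := by
    rw [← hDC, hDD', card_filter_split_bool (fun w : α → Bool => ¬ (openGraph (labelledOpen ends (zn w))).Reachable p q)
      (fun w => (openGraph (labelledOpen ends (zn fun l => !w l))).Reachable p q)]
    congr 1
    · exact congrArg Finset.card (Finset.filter_congr fun w _ => by simp only [iff_true])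
    · exact congrArg Finset.card (Finset.filter_congr fun w _ => by simp only [Bool.false_eq_true, iff_false])
  by_cases hπ : πp = true ∨ πq = true
  · -- a nonempty pattern
    have hor : (πp || πq) = true := by rcases hπ with h | h <;> simp [h]
    obtain ⟨h01, h11⟩ := nu_nonempty ends endsN p q inN hE1 hE2 zn hzn hzn0 Fn hFn1 hFn2 hFn0 πp πq hπ
    -- split `#{p ↔ q in zn}` and `#{p ↮ q in zn}` by the after state
    have sC := card_filter_split_bool (fun z : α → Bool => (openGraph (labelledOpen ends (zn z))).Reachable p q)
      (fun z => (openGraph (labelledOpen ends (Fn z πp πq))).Reachable p q)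
    have sD := card_filter_split_bool (fun z : α → Bool => ¬ (openGraph (labelledOpen ends (zn z))).Reachable p q)
      (fun z => (openGraph (labelledOpen ends (Fn z πp πq))).Reachable p q)
    rw [hCn] at sC
    rw [hDn] at sD
    have h11' : (univ.filter fun z : α → Bool => (openGraph (labelledOpen ends (zn z))).Reachable p q ∧
        ((openGraph (labelledOpen ends (Fn z πp πq))).Reachable p q ↔ true = true)).card = A' := by
      rw [hA', ← h11]; exact congrArg Finset.card (Finset.filter_congr fun z _ => by simp only [iff_true])
    have h01' : (univ.filter fun z : α → Bool => ¬ (openGraph (labelledOpen ends (zn z))).Reachable p q ∧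
        ((openGraph (labelledOpen ends (Fn z πp πq))).Reachable p q ↔ true = true)).card = CD' := by
      rw [hCD', ← h01]; exact congrArg Finset.card (Finset.filter_congr fun z _ => by simp only [iff_true])
    rw [h11'] at sC
    rw [h01'] at sD
    rw [hor]
    cases e <;> cases e' <;> simp only [cond_true, cond_false, Bool.false_eq_true, iff_false]
    · -- (0,0): DD'
      have : (univ.filter fun z : α → Bool => ¬ (openGraph (labelledOpen ends (zn z))).Reachable p q ∧
          ((openGraph (labelledOpen ends (Fn z πp πq))).Reachable p q ↔ false = true)).card = DD' := by omega
      rw [← this]; exact congrArg Finset.card (Finset.filter_congr fun z _ => by simp only [Bool.false_eq_true, iff_false])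
    · -- (0,1): CD'
      rw [← h01']; exact congrArg Finset.card (Finset.filter_congr fun z _ => by simp only [iff_true])
    · -- (1,0): CD'
      have : (univ.filter fun z : α → Bool => (openGraph (labelledOpen ends (zn z))).Reachable p q ∧
          ((openGraph (labelledOpen ends (Fn z πp πq))).Reachable p q ↔ false = true)).card = CD' := by omega
      rw [← this]; exact congrArg Finset.card (Finset.filter_congr fun z _ => by simp only [iff_true, Bool.false_eq_true, iff_false])
    · -- (1,1): A'
      rw [← h11']; exact congrArg Finset.card (Finset.filter_congr fun z _ => by simp only [iff_true])
  · -- the empty pattern: the flip is the identity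
    have hp0 : πp = false := by cases πp; rfl; exact absurd (Or.inl rfl) hπ
    have hq0 : πq = false := by cases πq; rfl; exact absurd (Or.inr rfl) hπ
    subst hp0; subst hq0
    have hid : ∀ z : α → Bool, Fn z false false = zn z := net_flip_none ends p q inN zn hzn hzn0 Fn hFn2 hFn0
    simp only [Bool.or_false, cond_false, hid]
    cases e <;> cases e' <;> simp only [beq_self_eq_true, Bool.false_eq_true, cond_true, cond_false, iff_false, iff_true,
      show (true == false) = false from rfl, show (false == true) = false from rfl]
    · rw [← hDn]; exact congrArg Finset.card (Finset.filter_congr fun z _ => by simp only [and_self])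
    · rw [Finset.card_eq_zero, Finset.filter_eq_empty_iff]; intro z _ h; exact h.1 h.2
    · rw [Finset.card_eq_zero, Finset.filter_eq_empty_iff]; intro z _ h; exact h.2 h.1
    · rw [← hCn]; exact congrArg Finset.card (Finset.filter_congr fun z _ => by simp only [and_self])

/-! ### 4. The substitution identity -/

include hN1 hN2 hp hq ha hs hc hE1 hE2 hzn hzn0 hzr hzr0 hRr hFl1 hFl2 hFl0 hFn1 hFn2 hFn0 hBd in
open Classical in
/-- **THE TWO-TERMINAL SUBSTITUTION IDENTITY FOR `#bad`.**  With `ρ(e,πp,πq,e') = #{Pat(e,πp,πq) ∧ BadR(e,e')}` (rest counts) and the antithetic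
class sizes `A', CD', DD'` of the network:
`#bad·#univ = A'·Σ_π ρ(1,π,1) + CD'·(ρ(1,∅,1) + ρ(0,∅,0) + Σ_{π ≠ ∅}(ρ(1,π,0) + ρ(0,π,1))) + DD'·Σ_π ρ(0,π,0)`. [this work] -/
theorem card_bad_substitution (ρ : Bool → Bool → Bool → Bool → ℕ)
    (hρ : ∀ e πp πq e', ρ e πp πq e' =
      (univ.filter fun z : α → Bool => ((Rr z e a p ↔ πp = true) ∧ (Rr z e a q ↔ πq = true)) ∧ Bd z e e').card)
    (A' CD' DD' : ℕ)
    (hA' : A' = (univ.filter fun w : α → Bool => (openGraph (labelledOpen ends (zn w))).Reachable p q ∧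
      (openGraph (labelledOpen ends (zn fun l => !w l))).Reachable p q).card)
    (hCD' : CD' = (univ.filter fun w : α → Bool => (openGraph (labelledOpen ends (zn w))).Reachable p q ∧
      ¬ (openGraph (labelledOpen ends (zn fun l => !w l))).Reachable p q).card)
    (hDD' : DD' = (univ.filter fun w : α → Bool => ¬ (openGraph (labelledOpen ends (zn w))).Reachable p q ∧
      ¬ (openGraph (labelledOpen ends (zn fun l => !w l))).Reachable p q).card) :
    (univ.filter fun z : α → Bool =>
        (¬ (openGraph (labelledOpen ends z)).Reachable a s ∧ ¬ (openGraph (labelledOpen ends z)).Reachable a c ∧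
          ¬ (openGraph (labelledOpen ends z)).Reachable s c) ∧
        (openGraph (labelledOpen ends (clusterFlip ends a fun x => !z x))).Reachable s c).card * (univ : Finset (α → Bool)).card =
      A' * (ρ true true true true + ρ true true false true + ρ true false true true + ρ true false false true) +
      CD' * (ρ true false false true + ρ false false false false +
        (ρ true true true false + ρ false true true true) + (ρ true true false false + ρ false true false true) +
        (ρ true false true false + ρ false false true true)) +
      DD' * (ρ false true true false + ρ false true false false + ρ false false true false + ρ false false false false) := by
  have hsplit := card_split4
    (fun z : α → Bool => (¬ (openGraph (labelledOpen ends z)).Reachable a s ∧ ¬ (openGraph (labelledOpen ends z)).Reachable a c ∧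
        ¬ (openGraph (labelledOpen ends z)).Reachable s c) ∧
      (openGraph (labelledOpen ends (clusterFlip ends a fun x => !z x))).Reachable s c)
    (fun z => (openGraph (labelledOpen ends (zn z))).Reachable p q)
    (fun e z => Rr z e a p) (fun e z => Rr z e a q)
    (fun e πp πq z => (openGraph (labelledOpen ends (Fn z πp πq))).Reachable p q)
  -- each piece, multiplied by `#univ`, is `ν · ρ`
  have hpiece : ∀ e πp πq e' : Bool, (univ.filter fun z : α → Bool =>
      (((((¬ (openGraph (labelledOpen ends z)).Reachable a s ∧ ¬ (openGraph (labelledOpen ends z)).Reachable a c ∧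
          ¬ (openGraph (labelledOpen ends z)).Reachable s c) ∧
        (openGraph (labelledOpen ends (clusterFlip ends a fun x => !z x))).Reachable s c) ∧
        ((openGraph (labelledOpen ends (zn z))).Reachable p q ↔ e = true)) ∧
        (Rr z e a p ↔ πp = true)) ∧
        (Rr z e a q ↔ πq = true)) ∧
        ((openGraph (labelledOpen ends (Fn z πp πq))).Reachable p q ↔ e' = true)).card * (univ : Finset (α → Bool)).card =
      (bif (πp || πq) then (bif e then (bif e' then A' else CD') else (bif e' then CD' else DD'))
        else (bif (e == e') then (bif e then A' + CD' else CD' + DD') else 0)) * ρ e πp πq e' := by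
    intro e πp πq e'
    rw [filter_bad_piece ends p q a s c Nv inN hN1 hN2 hp hq ha hs hc zn zr hzn hzn0 hzr hzr0 Rr hRr Fl hFl1 hFl2 hFl0 Fn hFn1 hFn2 hFn0
      Bd hBd e πp πq e',
      card_piece_mul_univ ends p q a s c inN zn zr hzn hzn0 hzr hzr0 Rr hRr Fl hFl1 hFl2 hFl0 Fn hFn1 hFn2 hFn0 Bd hBd e πp πq e',
      card_NE_eq ends endsN p q inN hE1 hE2 zn hzn hzn0 Fn hFn1 hFn2 hFn0 A' CD' DD' hA' hCD' hDD' e πp πq e', hρ]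
  beta_reduce at hsplit
  rw [hsplit]
  simp only [Finset.sum_mul]
  simp only [hpiece]
  simp only [Fintype.sum_bool, Bool.true_or, Bool.false_or, cond_true, cond_false, beq_self_eq_true,
    show (true == false) = false from rfl, show (false == true) = false from rfl]
  ring

end SubstitutionCount



end Summit.CriticalPhenomena.PercolationContinuityZ3.Theorems.ProductFormFibre
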